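import Summits.KontsevichZagierPeriods.KontsevichZagierPeriods.Theses.HurwitzMicroSectors
import Summits.KontsevichZagierPeriods.KontsevichZagierPeriods.Theorems.ReductionTwoSix.Negative.Relative
import Literature.NumberTheory.Transcendental.BoxCoordinatePowerMap
import Literature.NumberTheory.Transcendental.BoxIntegralZetaValues

/-!
# `ReductionTwoSix` (stmt-KontsevichZagierPeriods-3871, route HurwitzMicroSectors) — line `jacobian-monomials`

The crux: every integral representation `r` on the open box `B = (0,1)²` whose integrand agrees on `B`
with `P(xy)/(1 − (xy)⁶)`, `P ∈ ℚ[t]`, is KZ-equivalent to a representation on `B` with integrand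
`a + b/(1 − xy) + c/(1 + xy + x²y²)` for some `a b c : ℚ` (a NORMAL FORM of the level-6 weight-2
Hurwitz micro-sector).

Line (idea card `jacobian-monomials`: every monomial is a Jacobian; the three registered stubs are
proved in this file and composed in `reductionTwoSix_proof`). Euclid by `X⁶ − 1`:
`P = R + (X⁶ − 1)·Q`, `deg R < 6`, so on `B` the integrand splits (integrand additivity, rule 1b) as
`R(t)/(1 − t⁶) + (−Q)(t)`, `t = xy`.
* `stub_boxDilation` — the engine (the `n = 2` slice of item DilationMove): for `m ≥ 1` the
  coordinatewise power map `Φₘ(x) = (xᵢᵐ)ᵢ` is ONE change-of-variables move (rule 2) between two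
  representations on `B` whose integrands differ by the substitution and the Jacobian
  `m² (x₀x₁)^(m−1)` (Literature `BoxCoordinatePowerMap`: semialgebraic, injective, onto the box,
  `|det| = m² ∏ xᵢ^(m−1)`).
* `stub_polynomialPartByJacobians` — THE LEVER: `[Q(xy)]_B ∼ [Σ_k Q_k/(k+1)²]_B`, one dilation
  `m = k+1` per monomial applied to a constant (`(k+1)²(xy)^k` is a Jacobian); no Newton–Leibniz
  move, no change of dimension.
* `stub_polarPartLevelSix` — the level-6 part: for `deg R < 6` there are `b c : ℚ` with
  `[R(t)/(1−t⁶)]_B ∼ [b/(1−t) + c/(1+t+t²)]_B`: the dilations `m = 2, 3` realise the four Hurwitz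
  distribution relations among the residue classes `H_r = [t^r/(1−t⁶)]_B` (`H_r + H_{r+3} ∼ 4H_{2r+1}`,
  `H₁ + H₃ + H₅ ∼ 9H₅`) and exact `ℚ`-bookkeeping gives `b = (β+4α)/36`, `c = −α/8`.
Composition (`reductionTwoSix_proof`): every intermediate representation lives on the SAME open box
and is built by the landed constructor `sectorRep` (integrability from `1/(1−xy) ∈ L¹(B)`,
Literature `box_integral_one_div_one_sub_mul_two`); integrand additivity is read in the quotient
`FormalRep ⧸ relations` (`cls_add`), and the two stub equivalences are added there. The one-move
lemmas (`S_dil_monomial`, `S_q6_mul`, `S_lowDegree`, `bookkeeping`) are the landed refuter kit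
`Theorems/ReductionTwoSix/Negative/{Relative, Bookkeeping, NonVacuity, Kit}`. No definitions are
introduced and no unproved fact is used.

References: M. Kontsevich, D. Zagier, *Periods* (2001), §1.2 rules (1b), (2); J. Milnor, *On
polylogarithms, Hurwitz zeta functions, and the Kubert identities*, Enseign. Math. 29 (1983), §1
(distribution relations; the `m = k+1` dilation of a constant is the degenerate Kubert identity
`∬_B m²(xy)^{m−1} = 1`); S. Lang, *Cyclotomic Fields I–II* (1990), Ch. 2 §9.
-/

noncomputable section

open Set MeasureTheory
open scoped BigOperators
open Literature.NumberTheory.Transcendental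
open Summit.KontsevichZagierPeriods.HurwitzMicroSectors.ReductionTwoSixNegative

namespace Summit.KontsevichZagierPeriods.HurwitzMicroSectors.ReductionTwoSix

/-! ## Sector members on the box: polynomial, constant and polar integrands -/

open Polynomial in
/-- On the box, `sectorFun (N·(1−X⁶)) = N(xy)`: a polynomial integrand is the sector member
`N·(1−X⁶)`. [folklore] -/
theorem sectorFun_mul_oneSubX6 (N : ℚ[X]) {x : Fin 2 → ℝ} (hx : x ∈ box) :
    sectorFun (N * (1 - X ^ 6)) x = Polynomial.aeval (x 0 * x 1) N := by
  simp only [sectorFun, map_mul, map_sub, map_one, map_pow, Polynomial.aeval_X]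
  rw [mul_div_assoc, div_self (one_sub_t6_ne hx), mul_one]

open Polynomial in
/-- In the quotient by the moves, `[N·(1−X⁶)]` (the polynomial integrand `N(xy)` on the box) equals
the constant class `[Σ_k N_k/(k+1)² · (1−X⁶)]`, given the box dilations: `S_q6_mul` up to sign.
[cite: KontsevichZagier2001, §1.2 rule (2)] -/
theorem S_mul_oneSubX6 (hI : IntegrableOn (fun x : Fin 2 → ℝ => 1 / (1 - x 0 * x 1)) box)
    (hD : DilationMoveDim 2) (N : ℚ[X]) :
    S hI (N * (1 - X ^ 6)) = S hI (C (polyConst N) * (1 - X ^ 6)) := by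
  have e : N * (1 - X ^ 6) = -(q6 * N) := by unfold q6; simp only [map_one]; ring
  rw [e, map_neg, S_q6_mul hI hD N, ← map_neg, ← neg_mul, ← Polynomial.C_neg, neg_neg]

open Polynomial in
/-- On the box, `sectorFun (C q·(1−X⁶)) = q`: constants as sector members. [folklore] -/
theorem sectorFun_const (q : ℚ) {x : Fin 2 → ℝ} (hx : x ∈ box) :
    sectorFun (C q * (1 - X ^ 6)) x = (q : ℝ) := by
  rw [sectorFun_C_mul, sectorFun_oneSubX6 hx, mul_one]

open Polynomial in
/-- On the box, `sectorFun (C b·(1+X+⋯+X⁵) + C c·(1−X+X³−X⁴)) = b/(1−xy) + c/(1+xy+x²y²)`. [folklore] -/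
theorem sectorFun_polar (b c : ℚ) {x : Fin 2 → ℝ} (hx : x ∈ box) :
    sectorFun (C b * (1 + X + X ^ 2 + X ^ 3 + X ^ 4 + X ^ 5) + C c * (1 - X + X ^ 3 - X ^ 4)) x =
      (b : ℝ) / (1 - x 0 * x 1) + c / (1 + x 0 * x 1 + (x 0 * x 1) ^ 2) := by
  rw [sectorFun_add, sectorFun_C_mul, sectorFun_C_mul, sectorFun_pole hx, sectorFun_cubic hx]
  ring

open Polynomial in
/-- Euclid by `X⁶ − 1` read on the box: `P(t)/(1−t⁶) = R(t)/(1−t⁶) + (−Q)(t)` for `P = R + (X⁶−1)·Q`.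
[folklore] -/
theorem sectorFun_euclid (R Qt : ℚ[X]) {x : Fin 2 → ℝ} (hx : x ∈ box) :
    sectorFun (R + q6 * Qt) x = sectorFun R x + sectorFun (-Qt * (1 - X ^ 6)) x := by
  rw [sectorFun_mul_oneSubX6 _ hx]
  have h6 := one_sub_t6_ne hx
  unfold q6
  simp only [sectorFun, map_add, map_mul, map_sub, map_neg, map_pow, map_one, Polynomial.aeval_X]
  generalize x 0 * x 1 = t at h6 ⊢
  field_simp
  ring

/-! ## The three stubs of the line (registered on stmt-KontsevichZagierPeriods-3871), proved -/

/-- **STUB A of line `jacobian-monomials` (registered `stub_boxDilation` of crux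
stmt-KontsevichZagierPeriods-3871): the box dilation is one move.** For `m ≥ 1` and representations
`r, r'` on the open unit box `(0,1)²` with `r.integrand x = r'.integrand (xᵢᵐ)ᵢ · m² ∏ᵢ xᵢ^(m−1)`
on the box, `[r] − [r'] ∈ KZ.changeOfVariablesRel`, witnessed by `(Φ, Φ') = (Φₘ, Φₘ')`.
[cite: KontsevichZagier2001, §1.2 rule (2)] -/
theorem stub_boxDilation : ∀ (m : ℕ), 1 ≤ m → ∀ (r r' : KZ.IntegralRep 2), r.domain = {x | ∀ i, x i ∈ Set.Ioo (0:ℝ) 1} → r'.domain = {x | ∀ i, x i ∈ Set.Ioo (0:ℝ) 1} → (∀ x ∈ r.domain, r.integrand x = r'.integrand (fun i => x i ^ m) * ((m : ℝ) ^ 2 * ∏ i, x i ^ (m - 1))) → KZ.of r - KZ.of r' ∈ KZ.changeOfVariablesRel := by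
  intro m hm r r' hdom hdom' h
  have hm0 : m ≠ 0 := Nat.one_le_iff_ne_zero.mp hm
  refine ⟨2, r, r', BoxIntegral.coordPow m, BoxIntegral.coordPowDeriv m, ?_, ?_, ?_, ?_, ?_, rfl⟩
  · -- `Φₘ` is the polynomial map `(Xⱼ ^ m)ⱼ`, hence `ℚ`-semialgebraic on the box
    rw [hdom]
    exact (isSemialgebraicMapOn_aeval isSemialgebraic_box
      (fun j => (MvPolynomial.X j : MvPolynomial (Fin 2) ℚ) ^ m)).congr
      (fun x _ => by funext j; simp [BoxIntegral.coordPow])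
  · -- differentiable, with the diagonal derivative
    intro x _
    exact BoxIntegral.hasFDerivWithinAt_coordPow m _ x
  · -- injective on the box
    rw [hdom]
    exact BoxIntegral.injOn_coordPow_box hm0
  · -- the image of the box is the box
    rw [hdom', hdom]
    exact (BoxIntegral.image_coordPow_box hm0).symm
  · -- the Jacobian factor
    intro x hx
    rw [hdom] at hx
    rw [h x (hdom ▸ hx), BoxIntegral.abs_det_coordPowDeriv hm0 hx]
    rfl

open Polynomial in
/-- **STUB B of line `jacobian-monomials` (registered `stub_polynomialPartByJacobians` of crux
stmt-KontsevichZagierPeriods-3871): every monomial is a Jacobian.** Given the box dilations (for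
`m ≥ 1`, representations on the open box whose integrands differ by the substitution `xᵢ ↦ xᵢᵐ` and
the Jacobian `m² ∏ xᵢ^(m−1)` differ by ONE change-of-variables move), a representation on the open
box `(0,1)²` with integrand `Q(xy)`, `Q ∈ ℚ[t]`, is KZ-equivalent to any representation on the box
with the constant integrand `Σ_{k ≤ deg Q} Q_k/(k+1)²` (`∬_B (xy)^k = (k+1)⁻²`, realised move by
move: `[q(k+1)²(xy)^k]_B ∼ [q]_B` is the dilation `m = k+1` of a constant).
[cite: KontsevichZagier2001, §1.2 rule (2)] -/
theorem stub_polynomialPartByJacobians : (∀ (m : ℕ), 1 ≤ m → ∀ (r r' : KZ.IntegralRep 2), r.domain = {x | ∀ i, x i ∈ Set.Ioo (0:ℝ) 1} → r'.domain = {x | ∀ i, x i ∈ Set.Ioo (0:ℝ) 1} → (∀ x ∈ r.domain, r.integrand x = r'.integrand (fun i => x i ^ m) * ((m : ℝ) ^ 2 * ∏ i, x i ^ (m - 1))) → KZ.of r - KZ.of r' ∈ KZ.changeOfVariablesRel) → ∀ (Q : Polynomial ℚ) (r r' : KZ.IntegralRep 2), r.domain = {x | ∀ i, x i ∈ Set.Ioo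 (0:ℝ) 1} → r'.domain = {x | ∀ i, x i ∈ Set.Ioo (0:ℝ) 1} → Set.EqOn r.integrand (fun x => Polynomial.aeval (x 0 * x 1) Q) r.domain → Set.EqOn r'.integrand (fun _ => ((∑ k ∈ Finset.range (Q.natDegree + 1), Q.coeff k / ((k : ℚ) + 1) ^ 2 : ℚ) : ℝ)) r'.domain → KZ.Equivalent r r' := by
  intro hA Q r r' hdom hdom' hint hint'
  have hD : DilationMoveDim 2 := hA
  have hI : IntegrableOn (fun x : Fin 2 → ℝ => 1 / (1 - x 0 * x 1)) box :=
    box_integral_one_div_one_sub_mul_two.1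
  rw [← cls_eq_iff]
  -- `[r] = [Q·(1−X⁶)]` and `[r'] = [C a·(1−X⁶)]` in the quotient (same domain, integrands agree)
  have h1 : cls r = S hI (Q * (1 - Polynomial.X ^ 6)) := by
    rw [S_apply]
    refine cls_congr r _ (by rw [hdom]; rfl) fun x hx => ?_
    have hx' : x ∈ box := by rw [hdom] at hx; exact hx
    rw [hint hx, sectorRep_integrand, sectorFun_mul_oneSubX6 Q hx']
  have h2 : cls r' = S hI (Polynomial.C (polyConst Q) * (1 - Polynomial.X ^ 6)) := by
    rw [S_apply]
    refine cls_congr r' _ (by rw [hdom']; rfl) fun x hx => ?_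
    have hx' : x ∈ box := by rw [hdom'] at hx; exact hx
    rw [hint' hx, sectorRep_integrand, sectorFun_C_mul, sectorFun_oneSubX6 hx', mul_one]
    rfl
  rw [h1, S_mul_oneSubX6 hI hD Q, ← h2]

open Polynomial in
/-- **STUB C of line `jacobian-monomials` (registered `stub_polarPartLevelSix` of crux
stmt-KontsevichZagierPeriods-3871): the level-6 polar part.** Given the box dilations, for
`deg R < 6` there are `b c : ℚ` (namely `b = bCoeff p`, `c = cCoeff p`, `p r = R.coeff r`) such
that every representation on the open box with integrand `R(xy)/(1−(xy)⁶)` is KZ-equivalent to every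
representation on the box with integrand `b/(1−xy) + c/(1+xy+x²y²)`. [cite: Milnor1983, §1] -/
theorem stub_polarPartLevelSix : (∀ (m : ℕ), 1 ≤ m → ∀ (r r' : KZ.IntegralRep 2), r.domain = {x | ∀ i, x i ∈ Set.Ioo (0:ℝ) 1} → r'.domain = {x | ∀ i, x i ∈ Set.Ioo (0:ℝ) 1} → (∀ x ∈ r.domain, r.integrand x = r'.integrand (fun i => x i ^ m) * ((m : ℝ) ^ 2 * ∏ i, x i ^ (m - 1))) → KZ.of r - KZ.of r' ∈ KZ.changeOfVariablesRel) → ∀ (R : Polynomial ℚ), R.natDegree < 6 → ∃ b c : ℚ, ∀ (r r' : KZ.IntegralRep 2), r.domain = {x | ∀ i, x i ∈ Set.Ioo (0:ℝ) 1} → r'.domain = {x | ∀ i, x i ∈ Set.Ioo (0:ℝ) 1} → Set.EqOn r.integrand (fun x => Polynomial.aeval (x 0 * x 1) R / (1 - (x 0 * x 1) ^ 6)) r.domain → Set.EqOn r'.integrand (fun x => (b : ℝ) / (1 - x 0 * x 1) + c / (1 + x 0 * x 1 + (x 0 * x 1) ^ 2)) r'.domain → KZ.Equivalent r r' := by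
  intro hA R hR
  have hD : DilationMoveDim 2 := hA
  have hI : IntegrableOn (fun x : Fin 2 → ℝ => 1 / (1 - x 0 * x 1)) box :=
    box_integral_one_div_one_sub_mul_two.1
  refine ⟨bCoeff fun i : Fin 6 => R.coeff i, cCoeff fun i : Fin 6 => R.coeff i, ?_⟩
  intro r r' hdom hdom' hint hint'
  rw [← cls_eq_iff]
  -- `[r] = [R]` and `[r'] = [C b·(1+X+⋯+X⁵) + C c·(1−X+X³−X⁴)]` in the quotient
  have h1 : cls r = S hI R := by
    rw [S_apply]
    refine cls_congr r _ (by rw [hdom]; rfl) fun x hx => ?_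
    rw [hint hx, sectorRep_integrand]
    rfl
  have h2 : cls r' = S hI (C (bCoeff fun i : Fin 6 => R.coeff i) * (1 + X + X ^ 2 + X ^ 3 + X ^ 4 + X ^ 5) +
      C (cCoeff fun i : Fin 6 => R.coeff i) * (1 - X + X ^ 3 - X ^ 4)) := by
    rw [S_apply]
    refine cls_congr r' _ (by rw [hdom']; rfl) fun x hx => ?_
    have hx' : x ∈ box := by rw [hdom'] at hx; exact hx
    rw [hint' hx, sectorRep_integrand, sectorFun_polar _ _ hx']
  rw [h1, S_lowDegree hI hD R hR, ← h2]

/-! ## Composition: the stubs imply the crux -/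

section Composition

open Polynomial

/-- **The crux `ReductionTwoSix` from the stubs of line `jacobian-monomials`.** Euclid
`P = R + (X⁶−1)·Q`; integrand additivity splits `[P(t)/(1−t⁶)]_B = [R(t)/(1−t⁶)]_B + [(−Q)(t)]_B`;
`stub_polarPartLevelSix` moves the first summand to `[b/(1−t)+c/(1+t+t²)]_B`,
`stub_polynomialPartByJacobians` (fed with `stub_boxDilation`) moves the second to the constant
`[a]_B`, `a = Σ_k (−Q)_k/(k+1)²`; integrand additivity reassembles the normal form
`[a + b/(1−t) + c/(1+t+t²)]_B`. [cite: KontsevichZagier2001, §1.2] -/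
theorem reductionTwoSix_proof :
    Summit.KontsevichZagierPeriods.KontsevichZagierPeriods.Theses.HurwitzMicroSectors.ReductionTwoSix := by
  intro r P hdom hint
  -- `1/(1−xy)` is integrable on the open unit box (Literature: Beukers' `ζ(2)` integral)
  have hI : IntegrableOn (fun x : Fin 2 → ℝ => 1 / (1 - x 0 * x 1)) box :=
    box_integral_one_div_one_sub_mul_two.1
  -- Euclid by `X⁶ − 1`
  obtain ⟨R, hRdef⟩ : ∃ R : ℚ[X], R = P %ₘ q6 := ⟨_, rfl⟩
  obtain ⟨Qt, hQdef⟩ : ∃ Qt : ℚ[X], Qt = P /ₘ q6 := ⟨_, rfl⟩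
  have hP : P = R + q6 * Qt := by rw [hRdef, hQdef, Polynomial.modByMonic_add_div P q6]
  have hR : R.natDegree < 6 := by
    rw [hRdef, ← natDegree_q6]; exact Polynomial.natDegree_modByMonic_lt P q6_monic q6_ne_one
  -- the polar coefficients (stub C) and the constant of the polynomial part `−Q` (stub B)
  obtain ⟨b, c, hbc⟩ := stub_polarPartLevelSix stub_boxDilation R hR
  obtain ⟨a, ha⟩ : ∃ a : ℚ,
      a = ∑ k ∈ Finset.range ((-Qt).natDegree + 1), (-Qt).coeff k / ((k : ℚ) + 1) ^ 2 := ⟨_, rfl⟩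
  -- the witness: the normal-form member of the sector
  refine ⟨a, b, c, sectorRep hI (nfPoly a b c), rfl, fun x hx => sectorFun_nfPoly a b c hx, ?_⟩
  rw [← cls_eq_iff]
  -- step 1 (integrand additivity): `[r] = [R(t)/(1−t⁶)] + [(−Q)(t)]`
  have h1 : cls r = cls (sectorRep hI R) + cls (sectorRep hI (-Qt * (1 - X ^ 6))) :=
    cls_add r _ _ (by rw [hdom]; rfl) (by rw [hdom]; rfl) fun x hx => by
      have hx' : x ∈ box := by rw [hdom] at hx; exact hx
      rw [hint hx, Pi.add_apply, sectorRep_integrand, sectorRep_integrand, ← sectorFun_euclid R Qt hx',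
        ← hP]
      rfl
  -- step 2 (stub C): the polar part
  have h2 : cls (sectorRep hI R) =
      cls (sectorRep hI (C b * (1 + X + X ^ 2 + X ^ 3 + X ^ 4 + X ^ 5) + C c * (1 - X + X ^ 3 - X ^ 4))) :=
    cls_eq_iff.mpr (hbc _ _ rfl rfl (fun _ _ => rfl) fun x hx => sectorFun_polar b c hx)
  -- step 3 (stub B with stub A): the polynomial part is a constant
  have h3 : cls (sectorRep hI (-Qt * (1 - X ^ 6))) = cls (sectorRep hI (C a * (1 - X ^ 6))) :=
    cls_eq_iff.mpr (stub_polynomialPartByJacobians stub_boxDilation (-Qt) _ _ rfl rfl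
      (fun x hx => sectorFun_mul_oneSubX6 (-Qt) hx) fun x hx => by
        rw [← ha]; exact sectorFun_const a hx)
  -- step 4 (integrand additivity): the normal form is the sum of the two reduced parts
  have h4 : cls (sectorRep hI (nfPoly a b c)) = cls (sectorRep hI (C a * (1 - X ^ 6))) +
      cls (sectorRep hI (C b * (1 + X + X ^ 2 + X ^ 3 + X ^ 4 + X ^ 5) + C c * (1 - X + X ^ 3 - X ^ 4))) :=
    cls_add _ _ _ rfl rfl fun x hx => by
      rw [Pi.add_apply, sectorRep_integrand, sectorRep_integrand, sectorRep_integrand,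
        sectorFun_nfPoly a b c hx, sectorFun_const a hx, sectorFun_polar b c hx]
      ring
  rw [h1, h2, h3, h4, add_comm]

end Composition

end Summit.KontsevichZagierPeriods.HurwitzMicroSectors.ReductionTwoSix

end
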